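import Mathlib.Algebra.Order.Chebyshev
import Literature.Analysis.FunctionSpaces.TorusL4Interpolation
import Literature.Analysis.FluidPDE.CompressibleEulerResidualBounds
import HarnessLib

/-!
# From pointwise derivative sizes to `L²` energies on `𝕋^d`

Analysis/FluidPDE support file (everything proved; no named facts), part of the programme
proving `Literature.Analysis.FluidPDE.CompressibleEulerLocalWellPosedness` (Majda 1984,
Thms 2.1–2.2). The pointwise residual bounds of `CompressibleEulerResidualBounds` are of the form
`|R| ≤ K (1 + s₂ + s₃ + s₂²)` with the second/third derivative sizes `s₂, s₃` of `(ρ, u, ϑ)`;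
the energy estimate needs their squares INTEGRATED over the torus and compared with the `L²`
energies of the derivatives (Majda 1984, Ch. 2 §2.1, proof of Thm 2.2: `‖D²U‖²_{L⁴}` is
controlled by `‖DU‖_∞ ‖D³U‖_{L²}`, Prop. 2.1). This file records the conversions:

* the second/third-order `L²` energies `hsq₂ φ = ∑ᵢⱼ ∫ (∂ⱼ∂ᵢφ)²`, `hsq₃ φ`, `vsq₂ u`, `vsq₃ u`
  (sums over ALL coordinate words, matching `dsize₂/₃`, `vsize₂/₃`);
* `∫ (dsize₂ φ)² ≤ |d|² hsq₂ φ`, `∫ (dsize₃ φ)² ≤ |d|³ hsq₃ φ` (discrete Cauchy–Schwarz) and the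
  vector analogues;
* `∫ (dsize₂ φ)⁴ ≤ 9 |d|⁶ A² hsq₃ φ` when `|∂ᵢφ| ≤ A` (`TorusL4Interpolation`), and the vector
  analogue through the components;
* the resulting bound `∫ R² ≤ 4K²(1 + ∫s₂² + ∫s₃² + ∫s₂⁴)` for a continuous `R` with
  `|R| ≤ K(1 + s₂ + s₃ + s₂²)` (`integral_sq_le_of_pointwise`).

## References

* A. Majda, *Compressible Fluid Flow and Systems of Conservation Laws in Several Space
  Variables*, Springer 1984, Ch. 2 §2.1, Prop. 2.1, proof of Thm 2.2. [`Majda1984`]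
-/

noncomputable section

open Set Function MeasureTheory
open scoped ContDiff

namespace Literature.Analysis.FluidPDE

namespace CompressibleEuler

open Literature.Analysis.FunctionSpaces FunctionSpaces.Torus

variable {d : Type*} [Fintype d] [DecidableEq d]

/-! ## The `L²` energies of second and third derivatives -/

/-- `∑ᵢⱼ ∫ (∂ⱼ∂ᵢφ)²`. [folklore] -/
def hsq₂ (φ : UnitAddTorus d → ℝ) : ℝ := ∑ i, ∑ j, ∫ x, partialDeriv j (partialDeriv i φ) x ^ 2

/-- `∑ᵢⱼₖ ∫ (∂ₖ∂ⱼ∂ᵢφ)²`. [folklore] -/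
def hsq₃ (φ : UnitAddTorus d → ℝ) : ℝ := ∑ i, ∑ j, ∑ k, ∫ x, partialDeriv k (partialDeriv j (partialDeriv i φ)) x ^ 2

/-- `∑ᵢⱼ ∫ ‖∂ⱼ∂ᵢu‖²`. [folklore] -/
def vsq₂ (u : UnitAddTorus d → EuclideanSpace ℝ d) : ℝ := ∑ i, ∑ j, ∫ x, ‖partialDeriv j (partialDeriv i u) x‖ ^ 2

/-- `∑ᵢⱼₖ ∫ ‖∂ₖ∂ⱼ∂ᵢu‖²`. [folklore] -/
def vsq₃ (u : UnitAddTorus d → EuclideanSpace ℝ d) : ℝ :=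
  ∑ i, ∑ j, ∑ k, ∫ x, ‖partialDeriv k (partialDeriv j (partialDeriv i u)) x‖ ^ 2

/-- Energies are nonnegative. [folklore] -/
theorem hsq₂_nonneg (φ : UnitAddTorus d → ℝ) : 0 ≤ hsq₂ φ :=
  Finset.sum_nonneg fun _ _ => Finset.sum_nonneg fun _ _ => integral_nonneg fun _ => sq_nonneg _

/-- Energies are nonnegative. [folklore] -/
theorem hsq₃_nonneg (φ : UnitAddTorus d → ℝ) : 0 ≤ hsq₃ φ :=
  Finset.sum_nonneg fun _ _ => Finset.sum_nonneg fun _ _ => Finset.sum_nonneg fun _ _ =>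
    integral_nonneg fun _ => sq_nonneg _

/-- Energies are nonnegative. [folklore] -/
theorem vsq₂_nonneg (u : UnitAddTorus d → EuclideanSpace ℝ d) : 0 ≤ vsq₂ u :=
  Finset.sum_nonneg fun _ _ => Finset.sum_nonneg fun _ _ => integral_nonneg fun _ => sq_nonneg _

/-- Energies are nonnegative. [folklore] -/
theorem vsq₃_nonneg (u : UnitAddTorus d → EuclideanSpace ℝ d) : 0 ≤ vsq₃ u :=
  Finset.sum_nonneg fun _ _ => Finset.sum_nonneg fun _ _ => Finset.sum_nonneg fun _ _ =>
    integral_nonneg fun _ => sq_nonneg _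

/-! ## Squares of sizes against energies -/

section Squares

variable {F : Type*} [NormedAddCommGroup F] [NormedSpace ℝ F]

omit [DecidableEq d] in
/-- A generic conversion: if `g x = ∑_{m ∈ s} |a m x|` with each `a m` continuous, then
`∫ g² ≤ |s| ∑_m ∫ (a m)²`. [folklore] -/
theorem integral_sq_sum_abs_le {ι : Type*} (s : Finset ι) {a : ι → UnitAddTorus d → ℝ}
    (ha : ∀ m ∈ s, Continuous (a m)) :
    ∫ x, (∑ m ∈ s, |a m x|) ^ 2 ≤ (s.card : ℝ) * ∑ m ∈ s, ∫ x, a m x ^ 2 := by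
  have hpt : ∀ x, (∑ m ∈ s, |a m x|) ^ 2 ≤ (s.card : ℝ) * ∑ m ∈ s, a m x ^ 2 := fun x => by
    have h := sq_sum_le_card_mul_sum_sq (s := s) (f := fun m => |a m x|)
    simpa only [sq_abs] using h
  have hint : ∀ m ∈ s, Integrable (fun x => a m x ^ 2) volume := fun m hm =>
    ((ha m hm).pow 2).integrable_of_hasCompactSupport (HasCompactSupport.of_compactSpace _)
  have hcont : Continuous fun x => (∑ m ∈ s, |a m x|) ^ 2 :=
    (continuous_finsetSum s fun m hm => (ha m hm).abs).pow 2
  calc ∫ x, (∑ m ∈ s, |a m x|) ^ 2 ≤ ∫ x, (s.card : ℝ) * ∑ m ∈ s, a m x ^ 2 :=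
        integral_mono (hcont.integrable_of_hasCompactSupport (HasCompactSupport.of_compactSpace _))
          ((integrable_finsetSum s hint).const_mul _) hpt
    _ = (s.card : ℝ) * ∑ m ∈ s, ∫ x, a m x ^ 2 := by
        rw [integral_const_mul, integral_finsetSum s hint]

omit [DecidableEq d] in
/-- The fourth-power version: `∫ g⁴ ≤ |s|³ ∑_m ∫ (a m)⁴`. [folklore] -/
theorem integral_pow_four_sum_abs_le {ι : Type*} (s : Finset ι) {a : ι → UnitAddTorus d → ℝ}
    (ha : ∀ m ∈ s, Continuous (a m)) :
    ∫ x, (∑ m ∈ s, |a m x|) ^ 4 ≤ (s.card : ℝ) ^ 3 * ∑ m ∈ s, ∫ x, a m x ^ 4 := by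
  have hpt : ∀ x, (∑ m ∈ s, |a m x|) ^ 4 ≤ (s.card : ℝ) ^ 3 * ∑ m ∈ s, a m x ^ 4 := fun x => by
    -- Jensen / power mean (Mathlib `pow_sum_le_card_mul_sum_pow`)
    have h := pow_sum_le_card_mul_sum_pow (s := s) (f := fun m => |a m x|) (fun m _ => abs_nonneg _) 3
    have e : ∀ m, |a m x| ^ 4 = a m x ^ 4 := fun m => by
      rw [show (4 : ℕ) = 2 * 2 from rfl, pow_mul, pow_mul, sq_abs]
    simpa only [e] using h
  have hint : ∀ m ∈ s, Integrable (fun x => a m x ^ 4) volume := fun m hm =>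
    ((ha m hm).pow 4).integrable_of_hasCompactSupport (HasCompactSupport.of_compactSpace _)
  have hcont : Continuous fun x => (∑ m ∈ s, |a m x|) ^ 4 :=
    (continuous_finsetSum s fun m hm => (ha m hm).abs).pow 4
  calc ∫ x, (∑ m ∈ s, |a m x|) ^ 4 ≤ ∫ x, (s.card : ℝ) ^ 3 * ∑ m ∈ s, a m x ^ 4 :=
        integral_mono (hcont.integrable_of_hasCompactSupport (HasCompactSupport.of_compactSpace _))
          ((integrable_finsetSum s hint).const_mul _) hpt
    _ = (s.card : ℝ) ^ 3 * ∑ m ∈ s, ∫ x, a m x ^ 4 := by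
        rw [integral_const_mul, integral_finsetSum s hint]

/-- `∫ (dsize₂ φ)² ≤ |d|² hsq₂ φ` for smooth `φ`. [folklore] -/
theorem integral_dsize₂_sq_le {φ : UnitAddTorus d → ℝ} (hφ : IsSmooth φ) :
    ∫ x, dsize₂ φ x ^ 2 ≤ (Fintype.card d : ℝ) ^ 2 * hsq₂ φ := by
  have h := integral_sq_sum_abs_le (d := d) (Finset.univ : Finset (d × d))
    (a := fun m x => partialDeriv m.2 (partialDeriv m.1 φ) x)
    (fun m _ => ((hφ.partialDeriv m.1).partialDeriv m.2).continuous)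
  have e1 : ∀ x, dsize₂ φ x = ∑ m : d × d, |partialDeriv m.2 (partialDeriv m.1 φ) x| := fun x => by
    rw [dsize₂, ← Finset.univ_product_univ, Finset.sum_product]
  have e2 : hsq₂ φ = ∑ m : d × d, ∫ x, partialDeriv m.2 (partialDeriv m.1 φ) x ^ 2 := by
    rw [hsq₂, ← Finset.univ_product_univ, Finset.sum_product]
  simp_rw [e1]
  rw [e2, Finset.card_univ, Fintype.card_prod, Nat.cast_mul, ← sq] at *
  exact h

/-- `∫ (dsize₃ φ)² ≤ |d|³ hsq₃ φ` for smooth `φ`. [folklore] -/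
theorem integral_dsize₃_sq_le {φ : UnitAddTorus d → ℝ} (hφ : IsSmooth φ) :
    ∫ x, dsize₃ φ x ^ 2 ≤ (Fintype.card d : ℝ) ^ 3 * hsq₃ φ := by
  have h := integral_sq_sum_abs_le (d := d) (Finset.univ : Finset (d × d × d))
    (a := fun m x => partialDeriv m.2.2 (partialDeriv m.2.1 (partialDeriv m.1 φ)) x)
    (fun m _ => (((hφ.partialDeriv m.1).partialDeriv m.2.1).partialDeriv m.2.2).continuous)
  have e1 : ∀ x, dsize₃ φ x = ∑ m : d × d × d, |partialDeriv m.2.2 (partialDeriv m.2.1 (partialDeriv m.1 φ)) x| :=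
    fun x => by
      rw [dsize₃, ← Finset.univ_product_univ, Finset.sum_product]
      refine Finset.sum_congr rfl fun i _ => ?_
      rw [← Finset.univ_product_univ, Finset.sum_product]
  have e2 : hsq₃ φ = ∑ m : d × d × d, ∫ x, partialDeriv m.2.2 (partialDeriv m.2.1 (partialDeriv m.1 φ)) x ^ 2 := by
    rw [hsq₃, ← Finset.univ_product_univ, Finset.sum_product]
    refine Finset.sum_congr rfl fun i _ => ?_
    rw [← Finset.univ_product_univ, Finset.sum_product]
  simp_rw [e1]
  rw [e2]
  rw [Finset.card_univ, Fintype.card_prod, Fintype.card_prod, Nat.cast_mul, Nat.cast_mul] at h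
  calc _ ≤ _ := h
    _ = (Fintype.card d : ℝ) ^ 3 * _ := by ring

/-- `∫ (vsize₂ u)² ≤ |d|² vsq₂ u` for smooth `u`. [folklore] -/
theorem integral_vsize₂_sq_le {u : UnitAddTorus d → EuclideanSpace ℝ d} (hu : IsSmooth u) :
    ∫ x, vsize₂ u x ^ 2 ≤ (Fintype.card d : ℝ) ^ 2 * vsq₂ u := by
  have h := integral_sq_sum_abs_le (d := d) (Finset.univ : Finset (d × d))
    (a := fun m x => ‖partialDeriv m.2 (partialDeriv m.1 u) x‖)
    (fun m _ => ((hu.partialDeriv m.1).partialDeriv m.2).continuous.norm)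
  have e1 : ∀ x, vsize₂ u x = ∑ m : d × d, |‖partialDeriv m.2 (partialDeriv m.1 u) x‖| := fun x => by
    rw [vsize₂, ← Finset.univ_product_univ, Finset.sum_product]
    simp only [abs_norm]
  have e2 : vsq₂ u = ∑ m : d × d, ∫ x, ‖partialDeriv m.2 (partialDeriv m.1 u) x‖ ^ 2 := by
    rw [vsq₂, ← Finset.univ_product_univ, Finset.sum_product]
  simp_rw [e1]
  rw [e2, Finset.card_univ, Fintype.card_prod, Nat.cast_mul, ← sq] at *
  exact h

/-- `∫ (vsize₃ u)² ≤ |d|³ vsq₃ u` for smooth `u`. [folklore] -/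
theorem integral_vsize₃_sq_le {u : UnitAddTorus d → EuclideanSpace ℝ d} (hu : IsSmooth u) :
    ∫ x, vsize₃ u x ^ 2 ≤ (Fintype.card d : ℝ) ^ 3 * vsq₃ u := by
  have h := integral_sq_sum_abs_le (d := d) (Finset.univ : Finset (d × d × d))
    (a := fun m x => ‖partialDeriv m.2.2 (partialDeriv m.2.1 (partialDeriv m.1 u)) x‖)
    (fun m _ => (((hu.partialDeriv m.1).partialDeriv m.2.1).partialDeriv m.2.2).continuous.norm)
  have e1 : ∀ x, vsize₃ u x = ∑ m : d × d × d, |‖partialDeriv m.2.2 (partialDeriv m.2.1 (partialDeriv m.1 u)) x‖| :=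
    fun x => by
      rw [vsize₃, ← Finset.univ_product_univ, Finset.sum_product]
      refine Finset.sum_congr rfl fun i _ => ?_
      rw [← Finset.univ_product_univ, Finset.sum_product]
      simp only [abs_norm]
  have e2 : vsq₃ u = ∑ m : d × d × d, ∫ x, ‖partialDeriv m.2.2 (partialDeriv m.2.1 (partialDeriv m.1 u)) x‖ ^ 2 := by
    rw [vsq₃, ← Finset.univ_product_univ, Finset.sum_product]
    refine Finset.sum_congr rfl fun i _ => ?_
    rw [← Finset.univ_product_univ, Finset.sum_product]
  simp_rw [e1]
  rw [e2]
  rw [Finset.card_univ, Fintype.card_prod, Fintype.card_prod, Nat.cast_mul, Nat.cast_mul] at h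
  calc _ ≤ _ := h
    _ = (Fintype.card d : ℝ) ^ 3 * _ := by ring

end Squares

/-! ## Fourth powers of the second-derivative sizes against third-order energies -/

section Fourth

omit [DecidableEq d] in
/-- `‖w‖ ≤ ∑ᵢ |wᵢ|` in `ℝ^d` (private copy of the tree's `Torus.norm_le_sum_abs`, whose files are not in
this import cone). [folklore] -/
private theorem norm_le_sum_abs_apply (w : EuclideanSpace ℝ d) : ‖w‖ ≤ ∑ i, |w i| := by
  have h1 : ‖w‖ ^ 2 = ∑ i, |w i| ^ 2 := by
    rw [EuclideanSpace.norm_sq_eq]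
    exact Finset.sum_congr rfl fun i _ => by rw [Real.norm_eq_abs]
  have h2 : ∑ i, |w i| ^ 2 ≤ (∑ i, |w i|) ^ 2 := Finset.sum_sq_le_sq_sum_of_nonneg fun i _ => abs_nonneg _
  have h3 : 0 ≤ ∑ i, |w i| := Finset.sum_nonneg fun i _ => abs_nonneg _
  nlinarith [norm_nonneg w]

omit [DecidableEq d] in
/-- `∑ₚ (wₚ)² = ‖w‖²` in `ℝ^d`. [folklore] -/
theorem sum_sq_apply_eq (w : EuclideanSpace ℝ d) : ∑ p, w p ^ 2 = ‖w‖ ^ 2 := by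
  rw [EuclideanSpace.norm_sq_eq]
  exact Finset.sum_congr rfl fun i _ => by rw [Real.norm_eq_abs, sq_abs]

/-- Sub-sum: `∑ᵢⱼ ∫ (∂ⱼ∂ⱼ∂ᵢφ)² ≤ hsq₃ φ`. [folklore] -/
theorem sum_integral_diag_le_hsq₃ (φ : UnitAddTorus d → ℝ) :
    ∑ i, ∑ j, ∫ x, partialDeriv j (partialDeriv j (partialDeriv i φ)) x ^ 2 ≤ hsq₃ φ := by
  refine Finset.sum_le_sum fun i _ => Finset.sum_le_sum fun j _ => ?_
  exact Finset.single_le_sum (f := fun k => ∫ x, partialDeriv k (partialDeriv j (partialDeriv i φ)) x ^ 2)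
    (fun k _ => integral_nonneg fun x => sq_nonneg _) (Finset.mem_univ j)

/-- Sub-sum, vector: `∑ᵢⱼ ∫ ‖∂ⱼ∂ⱼ∂ᵢu‖² ≤ vsq₃ u`. [folklore] -/
theorem sum_integral_diag_le_vsq₃ (u : UnitAddTorus d → EuclideanSpace ℝ d) :
    ∑ i, ∑ j, ∫ x, ‖partialDeriv j (partialDeriv j (partialDeriv i u)) x‖ ^ 2 ≤ vsq₃ u := by
  refine Finset.sum_le_sum fun i _ => Finset.sum_le_sum fun j _ => ?_
  exact Finset.single_le_sum (f := fun k => ∫ x, ‖partialDeriv k (partialDeriv j (partialDeriv i u)) x‖ ^ 2)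
    (fun k _ => integral_nonneg fun x => sq_nonneg _) (Finset.mem_univ j)

/-- **`∫ (dsize₂ φ)⁴ ≤ 9 |d|⁶ A² hsq₃ φ`** for smooth `φ` with `|∂ᵢφ| ≤ A` (the `L⁴` interpolation
inequality, word by word). [cite: Majda1984, Ch. 2 §2.1 Prop. 2.1] -/
theorem integral_dsize₂_pow_four_le {φ : UnitAddTorus d → ℝ} (hφ : IsSmooth φ) {A : ℝ}
    (hA : ∀ x i, |partialDeriv i φ x| ≤ A) :
    ∫ x, dsize₂ φ x ^ 4 ≤ 9 * (Fintype.card d : ℝ) ^ 6 * A ^ 2 * hsq₃ φ := by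
  have h := integral_pow_four_sum_abs_le (d := d) (Finset.univ : Finset (d × d))
    (a := fun m x => partialDeriv m.2 (partialDeriv m.1 φ) x)
    (fun m _ => ((hφ.partialDeriv m.1).partialDeriv m.2).continuous)
  have e1 : ∀ x, dsize₂ φ x = ∑ m : d × d, |partialDeriv m.2 (partialDeriv m.1 φ) x| := fun x => by
    rw [dsize₂, ← Finset.univ_product_univ, Finset.sum_product]
  have h4 : ∀ m : d × d, ∫ x, partialDeriv m.2 (partialDeriv m.1 φ) x ^ 4 ≤
      9 * A ^ 2 * ∫ x, partialDeriv m.2 (partialDeriv m.2 (partialDeriv m.1 φ)) x ^ 2 := fun m =>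
    integral_partialDeriv_partialDeriv_pow_four_le hφ m.1 m.2 (fun x => hA x m.1)
  have hsum : ∑ m : d × d, ∫ x, partialDeriv m.2 (partialDeriv m.1 φ) x ^ 4 ≤ 9 * A ^ 2 * hsq₃ φ := by
    calc ∑ m : d × d, ∫ x, partialDeriv m.2 (partialDeriv m.1 φ) x ^ 4
        ≤ ∑ m : d × d, 9 * A ^ 2 * ∫ x, partialDeriv m.2 (partialDeriv m.2 (partialDeriv m.1 φ)) x ^ 2 :=
          Finset.sum_le_sum fun m _ => h4 m
      _ = 9 * A ^ 2 * ∑ i, ∑ j, ∫ x, partialDeriv j (partialDeriv j (partialDeriv i φ)) x ^ 2 := by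
          rw [← Finset.mul_sum, ← Finset.univ_product_univ, Finset.sum_product]
      _ ≤ 9 * A ^ 2 * hsq₃ φ := mul_le_mul_of_nonneg_left (sum_integral_diag_le_hsq₃ φ) (by positivity)
  simp_rw [e1]
  rw [Finset.card_univ, Fintype.card_prod, Nat.cast_mul] at h
  have hc : (0 : ℝ) ≤ Fintype.card d := Nat.cast_nonneg _
  calc _ ≤ _ := h
    _ ≤ ((Fintype.card d : ℝ) * Fintype.card d) ^ 3 * (9 * A ^ 2 * hsq₃ φ) :=
        mul_le_mul_of_nonneg_left hsum (by positivity)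
    _ = 9 * (Fintype.card d : ℝ) ^ 6 * A ^ 2 * hsq₃ φ := by ring

/-- Components of second derivatives: `(∂ⱼ∂ᵢu(x))ₚ = ∂ⱼ∂ᵢ(uₚ)(x)`. [folklore] -/
theorem partialDeriv₂_apply_coord {u : UnitAddTorus d → EuclideanSpace ℝ d} (hu : IsSmooth u) (i j p : d)
    (x : UnitAddTorus d) :
    partialDeriv j (partialDeriv i u) x p = partialDeriv j (partialDeriv i (fun z => u z p)) x := by
  rw [← partialDeriv_partialDeriv_apply hu i p j x, partialDeriv_apply_coord_fun hu i p]

/-- Components of third derivatives: `(∂ₖ∂ⱼ∂ᵢu(x))ₚ = ∂ₖ∂ⱼ∂ᵢ(uₚ)(x)`. [folklore] -/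
theorem partialDeriv₃_apply_coord {u : UnitAddTorus d → EuclideanSpace ℝ d} (hu : IsSmooth u) (i j k p : d)
    (x : UnitAddTorus d) :
    partialDeriv k (partialDeriv j (partialDeriv i u)) x p =
      partialDeriv k (partialDeriv j (partialDeriv i (fun z => u z p))) x := by
  rw [← partialDeriv₂_partialDeriv_apply hu i p j k x, partialDeriv_apply_coord_fun hu i p]

/-- **`∫ (vsize₂ u)⁴ ≤ 9 |d|⁹ A² vsq₃ u`** for smooth `u` with `‖∂ᵢu‖ ≤ A` (through the components).
[cite: Majda1984, Ch. 2 §2.1 Prop. 2.1] -/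
theorem integral_vsize₂_pow_four_le {u : UnitAddTorus d → EuclideanSpace ℝ d} (hu : IsSmooth u) {A : ℝ}
    (hA : ∀ x i, ‖partialDeriv i u x‖ ≤ A) :
    ∫ x, vsize₂ u x ^ 4 ≤ 9 * (Fintype.card d : ℝ) ^ 9 * A ^ 2 * vsq₃ u := by
  -- the dominating sum over words `(i, j, p)`
  set a : d × d × d → UnitAddTorus d → ℝ := fun m x => partialDeriv m.2.1 (partialDeriv m.1 (fun z => u z m.2.2)) x
    with ha
  have hac : ∀ m, Continuous (a m) := fun m =>
    (((hu.apply m.2.2).partialDeriv m.1).partialDeriv m.2.1).continuous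
  have hle : ∀ x, vsize₂ u x ≤ ∑ m : d × d × d, |a m x| := fun x => by
    rw [vsize₂, ← Finset.univ_product_univ, Finset.sum_product]
    refine Finset.sum_le_sum fun i _ => ?_
    rw [← Finset.univ_product_univ, Finset.sum_product]
    refine Finset.sum_le_sum fun j _ => ?_
    refine (norm_le_sum_abs_apply _).trans (le_of_eq (Finset.sum_congr rfl fun p _ => ?_))
    rw [partialDeriv₂_apply_coord hu i j p x]
  have hv0 : ∀ x, 0 ≤ vsize₂ u x := vsize₂_nonneg u
  have h1 : ∫ x, vsize₂ u x ^ 4 ≤ ∫ x, (∑ m : d × d × d, |a m x|) ^ 4 := by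
    have hc1 : Continuous fun x => vsize₂ u x := by
      unfold vsize₂
      exact continuous_finsetSum _ fun i _ => continuous_finsetSum _ fun j _ =>
        ((hu.partialDeriv i).partialDeriv j).continuous.norm
    have hc2 : Continuous fun x => (∑ m : d × d × d, |a m x|) ^ 4 :=
      (continuous_finsetSum _ fun m _ => (hac m).abs).pow 4
    exact integral_mono ((hc1.pow 4).integrable_of_hasCompactSupport (HasCompactSupport.of_compactSpace _))
      (hc2.integrable_of_hasCompactSupport (HasCompactSupport.of_compactSpace _))
      fun x => pow_le_pow_left₀ (hv0 x) (hle x) 4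
  have h2 := integral_pow_four_sum_abs_le (d := d) (Finset.univ : Finset (d × d × d)) (a := a) (fun m _ => hac m)
  have h4 : ∀ m : d × d × d, ∫ x, a m x ^ 4 ≤
      9 * A ^ 2 * ∫ x, partialDeriv m.2.1 (partialDeriv m.2.1 (partialDeriv m.1 (fun z => u z m.2.2))) x ^ 2 :=
    fun m => integral_partialDeriv_partialDeriv_pow_four_le (hu.apply m.2.2) m.1 m.2.1 fun x => by
      rw [partialDeriv_apply_coord (hu.isContDiff (by simp)) m.1 x m.2.2]
      exact (abs_apply_le_norm' _ _).trans (hA x m.1)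
  have hsum : ∑ m : d × d × d, ∫ x, a m x ^ 4 ≤ 9 * A ^ 2 * vsq₃ u := by
    calc ∑ m : d × d × d, ∫ x, a m x ^ 4
        ≤ ∑ m : d × d × d, 9 * A ^ 2 *
            ∫ x, partialDeriv m.2.1 (partialDeriv m.2.1 (partialDeriv m.1 (fun z => u z m.2.2))) x ^ 2 :=
          Finset.sum_le_sum fun m _ => h4 m
      _ = 9 * A ^ 2 * ∑ i, ∑ j, ∫ x, ‖partialDeriv j (partialDeriv j (partialDeriv i u)) x‖ ^ 2 := by
          rw [← Finset.mul_sum, ← Finset.univ_product_univ, Finset.sum_product]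
          congr 1
          refine Finset.sum_congr rfl fun i _ => ?_
          rw [← Finset.univ_product_univ, Finset.sum_product]
          refine Finset.sum_congr rfl fun j _ => ?_
          have hint : ∀ p : d, Integrable
              (fun x => partialDeriv j (partialDeriv j (partialDeriv i (fun z => u z p))) x ^ 2) volume := fun p =>
            (((((hu.apply p).partialDeriv i).partialDeriv j).partialDeriv j).continuous.pow 2).integrable_of_hasCompactSupport
              (HasCompactSupport.of_compactSpace _)
          rw [← integral_finsetSum _ fun p _ => hint p]
          congr 1
          funext x
          rw [← sum_sq_apply_eq]
          exact Finset.sum_congr rfl fun p _ => by rw [partialDeriv₃_apply_coord hu i j j p x]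
      _ ≤ 9 * A ^ 2 * vsq₃ u := mul_le_mul_of_nonneg_left (sum_integral_diag_le_vsq₃ u) (by positivity)
  rw [Finset.card_univ, Fintype.card_prod, Fintype.card_prod, Nat.cast_mul, Nat.cast_mul] at h2
  have hc : (0 : ℝ) ≤ Fintype.card d := Nat.cast_nonneg _
  calc ∫ x, vsize₂ u x ^ 4 ≤ _ := h1
    _ ≤ _ := h2
    _ ≤ ((Fintype.card d : ℝ) * ((Fintype.card d : ℝ) * Fintype.card d)) ^ 3 * (9 * A ^ 2 * vsq₃ u) :=
        mul_le_mul_of_nonneg_left hsum (by positivity)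
    _ = 9 * (Fintype.card d : ℝ) ^ 9 * A ^ 2 * vsq₃ u := by ring

end Fourth

/-! ## From a pointwise residual bound to an `L²` bound -/

section L2

omit [DecidableEq d] in
/-- If `|R| ≤ K(1 + s₂ + s₃ + s₂²)` pointwise with continuous `R, s₂, s₃` (and `s₂, s₃ ≥ 0`), then
`∫ R² ≤ 4K²(1 + ∫ s₂² + ∫ s₃² + ∫ s₂⁴)` on the unit-volume torus (mind the parentheses
around each integral). [folklore] -/
theorem integral_sq_le_of_pointwise {R s₂ s₃ : UnitAddTorus d → ℝ} (hR : Continuous R) (hs₂ : Continuous s₂)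
    (hs₃ : Continuous s₃) (h2 : ∀ x, 0 ≤ s₂ x) (h3 : ∀ x, 0 ≤ s₃ x) {K : ℝ} (hK : 0 ≤ K)
    (h : ∀ x, |R x| ≤ K * (1 + s₂ x + s₃ x + s₂ x * s₂ x)) :
    ∫ x, R x ^ 2 ≤ 4 * K ^ 2 * (1 + (∫ x, s₂ x ^ 2) + (∫ x, s₃ x ^ 2) + ∫ x, s₂ x ^ 4) := by
  have hpt : ∀ x, R x ^ 2 ≤ 4 * K ^ 2 * (1 + s₂ x ^ 2 + s₃ x ^ 2 + s₂ x ^ 4) := fun x => by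
    have h1 := h x
    have hR2 : R x ^ 2 = |R x| ^ 2 := (sq_abs _).symm
    have hpos : 0 ≤ K * (1 + s₂ x + s₃ x + s₂ x * s₂ x) := by
      have := h2 x; have := h3 x; positivity
    have h4 : |R x| ^ 2 ≤ (K * (1 + s₂ x + s₃ x + s₂ x * s₂ x)) ^ 2 := pow_le_pow_left₀ (abs_nonneg _) h1 2
    rw [hR2]
    refine h4.trans ?_
    nlinarith [h2 x, h3 x, sq_nonneg (s₂ x - 1), sq_nonneg (s₃ x - 1), sq_nonneg (s₂ x * s₂ x - 1),
      sq_nonneg (s₂ x - s₃ x), sq_nonneg (s₂ x * s₂ x - s₂ x), sq_nonneg (s₂ x * s₂ x - s₃ x), sq_nonneg K]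
  have ci : ∀ {f : UnitAddTorus d → ℝ}, Continuous f → Integrable f volume := fun hf =>
    hf.integrable_of_hasCompactSupport (HasCompactSupport.of_compactSpace _)
  have i1 : Integrable (fun x => s₂ x ^ 2) volume := ci (hs₂.pow 2)
  have i2 : Integrable (fun x => s₃ x ^ 2) volume := ci (hs₃.pow 2)
  have i3 : Integrable (fun x => s₂ x ^ 4) volume := ci (hs₂.pow 4)
  have i11 : Integrable (fun x => (1 : ℝ) + s₂ x ^ 2) volume := (integrable_const 1).add i1
  have i12 : Integrable (fun x => (1 : ℝ) + s₂ x ^ 2 + s₃ x ^ 2) volume := i11.add i2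
  have i13 : Integrable (fun x => (1 : ℝ) + s₂ x ^ 2 + s₃ x ^ 2 + s₂ x ^ 4) volume := i12.add i3
  calc ∫ x, R x ^ 2 ≤ ∫ x, 4 * K ^ 2 * (1 + s₂ x ^ 2 + s₃ x ^ 2 + s₂ x ^ 4) :=
        integral_mono (ci (hR.pow 2)) (i13.const_mul _) hpt
    _ = 4 * K ^ 2 * (1 + (∫ x, s₂ x ^ 2) + (∫ x, s₃ x ^ 2) + ∫ x, s₂ x ^ 4) := by
        rw [integral_const_mul, integral_add i12 i3, integral_add i11 i2, integral_add (integrable_const _) i1,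
          integral_const]
        simp

end L2

end CompressibleEuler

end Literature.Analysis.FluidPDE

end
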